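import Summits.QuantumFields.BalabanUV.T4Continuum.Support.NE7SliceCoarseDatumLetter
import Summits.QuantumFields.BalabanUV.T4Continuum.Support.AveragingDeficitMultiLevelBridge
import Summits.QuantumFields.BalabanUV.T4Continuum.Spine.NE3.QbarDictionary
import HarnessLib

/-!
# NE7SliceDoubleBar — THE DOUBLE-BAR AVERAGE OF AN (S1) STATE IS THE V-CONJUGATE OF ITS FRAME DEFECT `g = v⁻¹·e^{h}` (memo ROAD-G102 §11; [B7] (92)∕(159), [B8] (1.37))

Cell `pub-balaban`, lineage `t4-ne7-p1` (CRUX PROVER NE7 #1, owner of BINDER row NE7), gen 102.  The bridge from row NE7's slice states (`NE7SliceIterationState`: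
chart `U′^{u} = W·e^{X(u)}`, corner logs `h(u)`, shifted fibre `cavgIter(W·e^{X(u)}) = (cavgIter W)^{e^{h(u)}}` — `NE7SliceCoarseDatumLetter.cavgIter_state_eq_gaugeAct`)
to Bałaban's DOUBLE-BAR bookkeeping typed by the b07 lineage and used by the pub-balaban-gaps NE3 track (`Spine/NE3/`): with `U′ := relPert W X(u)` (so that
`U′·W = W·e^{X(u)}`, `Spine/NE3/PairLandauB8Avg.relPert_mul_eq_vary`), the FUNDAMENTAL EQUALITY `B7Eq92Concrete.avgIter_mul_eq_gaugeAct`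
(`(U′W)‾ᵏ = (U̿′ᵏ·W̄ᵏ)^{v_k}`, `v_k = vcov` the accumulated NONLINEAR frame (97), `U̿′ᵏ = dbavgCovIter` the double-bar average (90)) and the row-NE3-R2 bridge
`AveragingDeficitMultiLevelBridge.cavgIter_eq_avgIter` give, by pure group algebra (3 theorems, 0 def):
  `U̿′^{k+1} · V = V^{g}`, `g := v_{k+1}⁻¹ · e^{h(u)}`, `V = cavgIter L (k+1) W`  (`dbavgCovIter_state_mul_eq`), i.e. `U̿′^{k+1}(z,κ) = g(z)·V(z,κ)·g(z+e_κ)⁻¹·V(z,κ)⁻¹`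
  (`dbavgCovIter_state_eq`), and **`U̿′^{k+1} = 1 ⟺ V^{g} = V`** (`dbavgCovIter_state_eq_one_iff`): the (1.37) clause `dbar` of `Spine/NE3/PairLandauB8Avg.LandauRepB8Avg` holds
  at the NE7 state IFF the frame defect `v⁻¹e^{h}` stabilises the background's average — the NONLINEAR frame-matching condition that memo §11 recommends in place of the linear
  one (`framePotW(T⋆) = h⋆`), after which `Spine/NE3/RemainderL1FinalB8.dirL1_QbarIter_le_quadratic` ∕ `RemainderTowerB8` supply the k-free quadratic letters of the straight part.
-/

set_option autoImplicit false

open scoped BigOperators Matrix.Norms.L2Operator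
open NormedSpace Finset

namespace Summit.QuantumFields.BalabanUV.T4Continuum.NE7SliceDoubleBar

open Literature.MathematicalPhysics.QuantumFieldTheory.Balaban1983to89
open B7Prop1Explicit B7Prop2Explicit MatrixLog
open T4AveragingDeficitWall (IsUnitaryCfg IsSkewDir SmallField vary Ad)
open T4AveragingDeficitWallBoundary (IsPeriodicCfg)
open AveragingDeficitMultiLevelPrep (cavgIter LevelSmall tower)
open AveragingDeficitMultiLevelBridge (cavgIter_eq_avgIter)
open NE3EnergyShapes (IsUnitarySite IsPeriodicSite)
open NE7SliceIterationState (repLog cornerLog)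
open NE7SliceCoarseDatumLetter (cavgIter_state_eq_gaugeAct)
open B7Eq92Concrete (dbavgCovIter vcov avgIter_mul_eq_gaugeAct)
open NE3.PairLandauB8Avg (relPert relPert_mul_eq_vary)

noncomputable section

variable {d : ℕ} {n : Type*} [Fintype n] [DecidableEq n] [Nonempty n]

section State

variable {L : ℕ} (hL : 2 ≤ L) (k : ℕ) {W : Site d → Fin d → (Matrix n n ℂ)ˣ} (U' : Site d → Fin d → (Matrix n n ℂ)ˣ)
  (hU'u : IsUnitaryCfg U') {x' : ℝ} (hx'0 : 0 ≤ x') (hs' : LevelSmall d L k x') (hU'x : SmallField U' x')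
  (htop : cavgIter L (k + 1) U' = cavgIter L (k + 1) W)
  {u : Site d → (Matrix n n ℂ)ˣ} (hu : IsUnitarySite u)
  (hgauge : gaugeAct u U' = vary W (repLog W U' u) 1)
  (hcorner : ∀ z, ((u (((L : ℤ) ^ (k + 1)) • z) : (Matrix n n ℂ)ˣ) : Matrix n n ℂ) = exp (cornerLog L k u z))

include hL hU'u hx'0 hs' hU'x htop hu hgauge hcorner

/-- **THE FUNDAMENTAL EQUALITY AT THE STATE**: `v^{−1}`-regauged, `U̿′^{k+1} · V = V^{g}` with `g = v_{k+1}(U′)⁻¹ · e^{h(u)}`, `U′ = relPert W X(u)`, `V = cavgIter L (k+1) W`.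
[cite: Balaban1985Averaging, (92) p.31, (159) p.42] -/
theorem dbavgCovIter_state_mul_eq :
    dbavgCovIter L W (relPert W (repLog W U' u)) (k + 1) * cavgIter L (k + 1) W
      = gaugeAct ((vcov L W (relPert W (repLog W U' u)) (k + 1))⁻¹ * fun w => expUnit (cornerLog L k u w)) (cavgIter L (k + 1) W) := by
  -- the chart as a left perturbation, and the two readings of its (k+1)-fold average
  have hchart : vary W (repLog W U' u) 1 = relPert W (repLog W U' u) * W := (relPert_mul_eq_vary W (repLog W U' u)).symm
  have hfib := cavgIter_state_eq_gaugeAct hL k U' hU'u hx'0 hs' hU'x htop hu hgauge hcorner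
  rw [hchart, cavgIter_eq_avgIter, avgIter_mul_eq_gaugeAct, cavgIter_eq_avgIter] at hfib
  -- regauge by `v⁻¹` (composition of gauge actions `(V^{b})^{a} = V^{a·b}` — the tree's `N16SlotKeyGaugeQuotient.gaugeAct_gaugeAct`, inlined — and `V^{1} = V`)
  have hcomp : ∀ (a b : Site d → (Matrix n n ℂ)ˣ) (V : Site d → Fin d → (Matrix n n ℂ)ˣ), gaugeAct a (gaugeAct b V) = gaugeAct (a * b) V := by
    intro a b V; funext x μ; simp only [gaugeAct, Pi.mul_apply, mul_inv_rev, mul_assoc]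
  have hone : ∀ (V : Site d → Fin d → (Matrix n n ℂ)ˣ), gaugeAct (1 : Site d → (Matrix n n ℂ)ˣ) V = V := by
    intro V; funext x μ; simp [gaugeAct]
  have h := congrArg (gaugeAct (vcov L W (relPert W (repLog W U' u)) (k + 1))⁻¹) hfib
  rw [hcomp, hcomp, inv_mul_cancel, hone] at h
  rw [cavgIter_eq_avgIter]
  exact h

/-- **THE DOUBLE-BAR AVERAGE OF THE STATE, BONDWISE**: `U̿′^{k+1}(z,κ) = g(z)·V(z,κ)·g(z+e_κ)⁻¹·V(z,κ)⁻¹`, `g = v⁻¹·e^{h(u)}`. [cite: Balaban1985Averaging, (159) p.42] -/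
theorem dbavgCovIter_state_eq (z : Site d) (κ : Fin d) :
    dbavgCovIter L W (relPert W (repLog W U' u)) (k + 1) z κ
      = (vcov L W (relPert W (repLog W U' u)) (k + 1))⁻¹ z * expUnit (cornerLog L k u z) * cavgIter L (k + 1) W z κ
          * ((vcov L W (relPert W (repLog W U' u)) (k + 1))⁻¹ (z + e κ) * expUnit (cornerLog L k u (z + e κ)))⁻¹ * (cavgIter L (k + 1) W z κ)⁻¹ := by
  have h := congrFun (congrFun (dbavgCovIter_state_mul_eq hL k U' hU'u hx'0 hs' hU'x htop hu hgauge hcorner) z) κ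
  simp only [Pi.mul_apply, gaugeAct] at h
  rw [← h, mul_inv_cancel_right]

/-- **(1.37) AT THE STATE IS A FRAME CONDITION**: `U̿′^{k+1} = 1 ⟺ V^{g} = V`, `g = v_{k+1}(U′)⁻¹·e^{h(u)}` — the double-bar clause `dbar` of `LandauRepB8Avg` holds at the
NE7 state iff the frame defect between the NONLINEAR accumulated frame `v_{k+1}` and the corner transformation `e^{h(u)}` stabilises `V = cavgIter L (k+1) W`.
[cite: Balaban1985RegularSpaces, (1.37) p.82] -/
theorem dbavgCovIter_state_eq_one_iff :
    dbavgCovIter L W (relPert W (repLog W U' u)) (k + 1) = 1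
      ↔ gaugeAct ((vcov L W (relPert W (repLog W U' u)) (k + 1))⁻¹ * fun w => expUnit (cornerLog L k u w)) (cavgIter L (k + 1) W)
          = cavgIter L (k + 1) W := by
  have h := dbavgCovIter_state_mul_eq hL k U' hU'u hx'0 hs' hU'x htop hu hgauge hcorner
  constructor
  · intro h1
    rw [h1, one_mul] at h
    exact h.symm
  · intro h2
    rw [h2] at h
    exact mul_right_cancel (h.trans (one_mul _).symm) |>.trans rfl

end State

end

end Summit.QuantumFields.BalabanUV.T4Continuum.NE7SliceDoubleBar
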